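import Summits.QuantumFields.BalabanUV.Beta.EriceFlowEnclosureB12AsPrintedHistoryContagionShiftFlowZeroTangentFlow
import Mathlib.Analysis.SpecialFunctions.Sqrt
import Mathlib.Analysis.Calculus.Deriv.Inv
import Mathlib.Analysis.Calculus.Deriv.Slope

/-!
# Beta / EriceFlowEnclosureB12AsPrintedHistoryContagionShiftFlowZeroTangentDeriv — ASYMPTOTIC FREEDOM IS CONTAGIOUS, part 69: THE SOLUTION IS DIFFERENTIABLE IN ITS PIN AT
# EVERY SCALE, WITH DERIVATIVE THE TANGENT FLOW.  FOR THE FLOW (part 14's package at e′) under part 68's def-free C¹ shape (`hG`: gradient with the memory profile; `hGB`: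
# uniform first-order remainder): (§114) for two pins e ≠ ẽ of ]0, e′] the chart quotients `D_k = (1∕h̃_k² − 1∕h_k²)∕(1∕ẽ² − 1∕e²)` and the tangent flow W at e are, AT EVERY
# SCALE AT ONCE, **`|D_k − W_k| ≤ (8∕7)·((2∕3)εS∕(1−θ) + (4∕3)e′²·|1∕ẽ² − 1∕e²|)`** (`S = 8e′³ + 16e′∕β*`) whenever B's remainder is ε-small at sup-distance `(16∕3)e′³|1∕ẽ² −
# 1∕e²|` (which dominates `sup_q |h̃_q − h_q|`) — ONE application of part 66's `fixedPoint_perturb` to part 68's `quotient_identity` (sources `(2∕3)εS∕(1−θ)`-close, Jacobians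
# `μ` vs `h³∕2` profile-close with `η = (8∕3)e′²|1∕ẽ² − 1∕e²|`); (§115) hence **`sup_k |D_k − W_k| → 0` as ẽ → e** (`quotient_tendsto_tangent_uniform`, filter form on
# `𝓝[≠] e` for interior e); (§116) hence at every interior pin and every scale **`HasDerivAt (e ↦ 1∕(solution B e k)²) (W_k·(−2∕e³)) e`** and
# **`HasDerivAt (e ↦ solution B e k) (W_k·h_k³∕e³) e`** — THE solution of the flow with memory is differentiable in its pin, the derivative is the tangent flow read
# through the chart, positive (`W_k ≥ 3∕4`).  The uniformity in k of §115 is what part 70 turns into the derivative of the Λ-coordinate WITHOUT a uniform-limit theorem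
# (β-flow team, prover 1, unit `b2b-balaban-beta-bflow-p1`, gen 42; ROW AP-I·Uc × NODE U2)

HONEST FRAMING (page 1 of everything the β sub-cell writes): discharging `BetaPertH` makes Bałaban's UV stability UNCONDITIONAL — a
real constructive-QFT result; it is NOT the continuum limit and NOT the Clay problem.  HONEST DEPENDENCY (cell reorg 2026-08-19,
verbatim): «continuum YM on T⁴ ⇐ BetaPertH ∧ nine spine estimates (0/9 proved); BetaPertH ⇐ (D1) ∧ (D4) ∧ CAP+tail; G-an2-4 gates
asym, D1 and NE2/3/4.»  THIS MODULE DISCHARGES NOTHING: [folklore] real analysis (parts 66–68 by name; ε–δ bookkeeping; the slope characterisation of the derivative and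
the chain rule for `1∕√·`, from Mathlib) over node U2's HYPOTHESIS SHAPES `T4BetaStationary.{SeqBox, MemoryProfile}`, `T4BetaFlowWellPosed.{MemFlow, solution}` consumed BY
NAME (NOT PRINTED for [I] = T. Bałaban, Commun. Math. Phys. **109** (1987) [Balaban1987RG1]: p. 298 says only that β_j depends on the preceding couplings; (0.20) p. 256;
Theorem 2 (0.31) p. 259 STATED WITHOUT PROOF).  The C¹ shape is OUR explicit binder.  Nothing of Bałaban's β is asserted.

WHAT THIS FILE PROVES (0 sorry, 0 def): §114 `invSq_sub_ne_zero`, `abs_sub_pins_le_of_quotient`, **`quotient_sub_tangent_abs_le`**; §115 `invSq_sub_invSq_tendsto_zero`,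
**`quotient_tendsto_tangent_uniform`**, `quotient_tendsto_tangent`; §116 **`hasDerivAt_invSq_solution`**, **`hasDerivAt_solution`**, `deriv_solution_pos`.  NOT CLAIMED: the
derivative of the Λ-coordinate (part 70); anything about Bałaban's β; `BetaPertH`; the continuum limit of the measures; Clay.
-/

namespace Summit.QuantumFields.BalabanUV.Beta.EriceFlowEnclosureB12AsPrintedHistoryContagionShiftFlowZeroTangentDeriv

open Finset Filter Topology Set
open Literature.MathematicalPhysics.QuantumFieldTheory.Balaban1983to89
open Literature.MathematicalPhysics.QuantumFieldTheory.Balaban1983to89.T4CouplingMatching (prof sprof sprof_pos sprof_sq prof_pos sprof_zero)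
open Literature.MathematicalPhysics.QuantumFieldTheory.Balaban1983to89.T4BetaStationary (SeqBox MemoryProfile summable_profile abs_sub_le_of_seqBox)
open Literature.MathematicalPhysics.QuantumFieldTheory.Balaban1983to89.T4BetaFlowWellPosed (MemFlow drive solution seqBox_shift invSq_eq_of_memFlow)
open Summit.QuantumFields.BalabanUV.Beta.EriceFlowEnclosureB12AsPrintedHistoryContagionShiftFlowZeroTangent (row_summable_abs_le kernel_abs_le abs_term_le
  term_summable fixedPoint_perturb)
open Summit.QuantumFields.BalabanUV.Beta.EriceFlowEnclosureB12AsPrintedHistoryContagionShiftFlowZeroTangentLimit (profWeight_nonneg profWeight_anti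
  sum_profWeight_le sum_profWeight_succ_le)
open Summit.QuantumFields.BalabanUV.Beta.EriceFlowEnclosureB12AsPrintedHistoryContagionShiftFlowZeroTangentFlow (solution_facts tangent_data smallness_of_hs5
  tangent_sub_one_abs_le quotient_mem_Icc mu_facts sub_eq_mu_mul abs_mu_sub_cube_le quotient_identity)

noncomputable section

/-! ## §114 The chart quotients against the tangent flow: one application of `fixedPoint_perturb` -/

/-- Distinct positive pins have distinct charts: `1∕ẽ² − 1∕e² ≠ 0`. [folklore] -/
theorem invSq_sub_ne_zero {e ee : ℝ} (he : 0 < e) (hee : 0 < ee) (hne : ee ≠ e) : 1 / ee ^ 2 - 1 / e ^ 2 ≠ 0 := by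
  intro h0
  have h1 : e ^ 2 = ee ^ 2 := by
    have := (div_eq_div_iff (pow_ne_zero 2 hee.ne') (pow_ne_zero 2 he.ne')).mp (sub_eq_zero.mp h0)
    linarith
  exact hne ((pow_left_inj₀ hee.le he.le two_ne_zero).mp h1.symm)

/-- THE COUPLING SEPARATION THROUGH THE CHART INCREMENT: for two pins e ≠ ẽ of ]0, e′], at every scale `|h̃_q − h_q| ≤ (2∕3)·w_q·|1∕ẽ² − 1∕e²| ≤ (16∕3)e′³·|1∕ẽ² − 1∕e²|`
(`h̃ − h = −(1∕ẽ² − 1∕e²)·μ·D`, `μ ≤ w∕2`, `|D| ≤ 4∕3`, `w_q ≤ w_0 = 8e′³`). [cite: Balaban1987RG1, Thm 2 (0.31) p.259 with (0.20) p.256] -/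
theorem abs_sub_pins_le_of_quotient {B : (ℕ → ℝ) → ℝ} {Cm θ γ bs ta gs e' : ℝ} {t : ℕ → ℝ}
    (hB : MemoryProfile Cm θ γ B) (hCm : 0 ≤ Cm) (hθ0 : 0 ≤ θ) (hθ1 : θ < 1) (hbs : 0 < bs) (hta : 0 < ta)
    (hts : SeqBox γ t) (htf : MemFlow B gs t) (hprof : ∀ m : ℕ, 1 / ta ^ 2 + bs * (m : ℝ) ≤ 1 / (t m) ^ 2)
    (h2e' : 2 * e' ≤ γ) (hs1 : 4 * Cm * e' ≤ bs * (1 - θ))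
    (hs2 : e' ^ 2 * (1 / gs ^ 2 + Cm * γ / (1 - θ) ^ 2 + (2 * Cm / ((1 - θ) * bs)) ^ 2) ≤ 3 / 4)
    (hs4 : 64 * Cm * e' ^ 3 ≤ (1 - θ) ^ 2) (hs5 : Cm * (8 * e' ^ 3 + 16 * e' / bs) ≤ (1 - θ) / 4)
    {e ee : ℝ} (he : e ∈ Ioc (0 : ℝ) e') (hee : ee ∈ Ioc (0 : ℝ) e') (hne : ee ≠ e) (q : ℕ) :
    |solution B ee q - solution B e q| ≤ 2 / 3 * (1 / (sprof (2 * e') (bs / 4) q) ^ 2 * (1 / sprof (2 * e') (bs / 4) q)) * |1 / ee ^ 2 - 1 / e ^ 2| ∧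
      |solution B ee q - solution B e q| ≤ 16 / 3 * e' ^ 3 * |1 / ee ^ 2 - 1 / e ^ 2| := by
  have he' : 0 < e' := he.1.trans_le he.2
  obtain ⟨hsb, -, -, hle, -, -⟩ := solution_facts hB hCm hθ0 hθ1 hbs hta hts htf hprof h2e' hs1 hs2 hs4 hs5 he
  obtain ⟨hsbb, -, -, hlee, -, -⟩ := solution_facts hB hCm hθ0 hθ1 hbs hta hts htf hprof h2e' hs1 hs2 hs4 hs5 hee
  obtain ⟨-, -, hD⟩ := quotient_mem_Icc hB hCm hθ0 hθ1 hbs hta hts htf hprof h2e' hs1 hs2 hs4 hs5 he hee hne q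
  obtain ⟨hμ0, hμ⟩ := mu_facts (hsb q).1 (hsbb q).1 (hle q) (hlee q)
  rw [one_div_one_div] at hμ
  set w : ℝ := 1 / (sprof (2 * e') (bs / 4) q) ^ 2 * (1 / sprof (2 * e') (bs / 4) q) with hw
  have hw0 : 0 ≤ w := profWeight_nonneg hbs he' q
  have hδne : 1 / ee ^ 2 - 1 / e ^ 2 ≠ 0 := invSq_sub_ne_zero he.1 hee.1 hne
  have heq := sub_eq_mu_mul (hsb q).1 (hsbb q).1
  have h1 : |solution B ee q - solution B e q| ≤ 2 / 3 * w * |1 / ee ^ 2 - 1 / e ^ 2| := by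
    rw [heq, abs_mul, abs_neg]
    rw [abs_of_nonneg hμ0] at hμ
    calc |1 / solution B ee q ^ 2 - 1 / solution B e q ^ 2| * |solution B e q ^ 2 * solution B ee q ^ 2 / (solution B e q + solution B ee q)|
        = |(1 / solution B ee q ^ 2 - 1 / solution B e q ^ 2) / (1 / ee ^ 2 - 1 / e ^ 2)| * |1 / ee ^ 2 - 1 / e ^ 2|
          * (solution B e q ^ 2 * solution B ee q ^ 2 / (solution B e q + solution B ee q)) := by
          rw [abs_of_nonneg hμ0, ← abs_mul, div_mul_cancel₀ _ hδne]
      _ ≤ 4 / 3 * |1 / ee ^ 2 - 1 / e ^ 2| * (w / 2) :=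
          mul_le_mul (mul_le_mul_of_nonneg_right hD (abs_nonneg _)) hμ hμ0 (by positivity)
      _ = 2 / 3 * w * |1 / ee ^ 2 - 1 / e ^ 2| := by ring
  refine ⟨h1, h1.trans ?_⟩
  have hw8 : w ≤ 8 * e' ^ 3 := by
    have h := profWeight_anti hbs he' (Nat.zero_le q)
    rw [sprof_zero (by positivity : (0:ℝ) < 2 * e')] at h
    have e8 : 1 / (1 / (2 * e')) ^ 2 * (1 / (1 / (2 * e'))) = 8 * e' ^ 3 := by field_simp; ring
    rw [e8] at h
    exact h
  nlinarith [abs_nonneg (1 / ee ^ 2 - 1 / e ^ 2)]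

/-- **THE CHART QUOTIENTS AGAINST THE TANGENT FLOW, AT EVERY SCALE AT ONCE.**  Part 14's package at e′; the gradient profile `hG`; an ε-remainder bound for B at sup-distance ρ
(one instance of part 68's `hGB`); W the tangent flow at `e ∈ ]0, e′]` (`|W| ≤ 2`); a second pin `ẽ ∈ ]0, e′]`, `ẽ ≠ e`, with `(16∕3)e′³|1∕ẽ² − 1∕e²| ≤ ρ`.  THEN for EVERY k:
**`|D_k − W_k| ≤ (8∕7)·((2∕3)·ε·S∕(1−θ) + (4∕3)·e′²·|1∕ẽ² − 1∕e²|)`**, `S = 8e′³ + 16e′∕β*` — part 66's `fixedPoint_perturb` on part 68's `quotient_identity`.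
[cite: Balaban1987RG1, Thm 2 (0.31) p.259 with (0.20) p.256 and p.298] -/
theorem quotient_sub_tangent_abs_le {B : (ℕ → ℝ) → ℝ} {G : (ℕ → ℝ) → ℕ → ℝ} {Cm θ γ bs ta gs e' ε ρ : ℝ} {t W : ℕ → ℝ}
    (hB : MemoryProfile Cm θ γ B) (hCm : 0 ≤ Cm) (hθ0 : 0 ≤ θ) (hθ1 : θ < 1) (hbs : 0 < bs) (hta : 0 < ta)
    (hts : SeqBox γ t) (htf : MemFlow B gs t) (hprof : ∀ m : ℕ, 1 / ta ^ 2 + bs * (m : ℝ) ≤ 1 / (t m) ^ 2)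
    (hG : ∀ u : ℕ → ℝ, SeqBox γ u → ∀ j, |G u j| ≤ Cm * θ ^ j) (hε : 0 ≤ ε)
    (hrem : ∀ u u' : ℕ → ℝ, SeqBox γ u → SeqBox γ u' → (∀ j, |u' j - u j| ≤ ρ) →
      |B u' - B u - ∑' j, G u j * (u' j - u j)| ≤ ε * ∑' j, θ ^ j * |u' j - u j|)
    (h2e' : 2 * e' ≤ γ) (hs1 : 4 * Cm * e' ≤ bs * (1 - θ))
    (hs2 : e' ^ 2 * (1 / gs ^ 2 + Cm * γ / (1 - θ) ^ 2 + (2 * Cm / ((1 - θ) * bs)) ^ 2) ≤ 3 / 4)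
    (hs4 : 64 * Cm * e' ^ 3 ≤ (1 - θ) ^ 2) (hs5 : Cm * (8 * e' ^ 3 + 16 * e' / bs) ≤ (1 - θ) / 4)
    {e ee : ℝ} (he : e ∈ Ioc (0 : ℝ) e') (hee : ee ∈ Ioc (0 : ℝ) e') (hne : ee ≠ e) (hρ : 16 / 3 * e' ^ 3 * |1 / ee ^ 2 - 1 / e ^ 2| ≤ ρ)
    (hW : ∀ k, W k = 1 - ∑ p ∈ range k, ∑' j, G (fun i => solution B e (p + 1 + i)) j * ((solution B e (p + 1 + j)) ^ 3 / 2) * W (p + 1 + j))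
    (hWM : ∀ k, |W k| ≤ 2) (k : ℕ) :
    |(1 / (solution B ee k) ^ 2 - 1 / (solution B e k) ^ 2) / (1 / ee ^ 2 - 1 / e ^ 2) - W k|
      ≤ 8 / 7 * (2 / 3 * ε * (8 * e' ^ 3 + 16 * e' / bs) / (1 - θ) + 4 / 3 * e' ^ 2 * |1 / ee ^ 2 - 1 / e ^ 2|) := by
  have he' : 0 < e' := he.1.trans_le he.2
  have h1θ : 0 < 1 - θ := by linarith
  set S : ℝ := 8 * e' ^ 3 + 16 * e' / bs with hS
  set δ : ℝ := 1 / ee ^ 2 - 1 / e ^ 2 with hδ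
  set h : ℕ → ℝ := solution B e with hdef
  set hh : ℕ → ℝ := solution B ee with hhdef
  set w : ℕ → ℝ := fun q => 1 / (sprof (2 * e') (bs / 4) q) ^ 2 * (1 / sprof (2 * e') (bs / 4) q) with hw
  obtain ⟨hsb, hsf, -, hle, h2, hcube⟩ := solution_facts hB hCm hθ0 hθ1 hbs hta hts htf hprof h2e' hs1 hs2 hs4 hs5 he
  obtain ⟨hsbb, hsff, -, hlee, -, -⟩ := solution_facts hB hCm hθ0 hθ1 hbs hta hts htf hprof h2e' hs1 hs2 hs4 hs5 hee
  obtain ⟨hc, hv⟩ := tangent_data (B := B) (e' := e') hG hsb hcube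
  obtain ⟨hq8, hq, hq4⟩ := smallness_of_hs5 (Cm := Cm) (bs := bs) (e' := e') hθ1 hs5
  have hw0 : ∀ q, 0 ≤ w q := profWeight_nonneg hbs he'
  have hwanti : ∀ {a b : ℕ}, a ≤ b → w b ≤ w a := fun hab => profWeight_anti hbs he' hab
  have hwS : ∀ m, ∑ q ∈ range (m + 1), w q ≤ S := sum_profWeight_le hbs he'
  have hδne : δ ≠ 0 := invSq_sub_ne_zero he.1 hee.1 hne
  -- pointwise objects
  have hD : ∀ q, |(1 / (hh q) ^ 2 - 1 / (h q) ^ 2) / δ| ≤ 4 / 3 := fun q =>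
    (quotient_mem_Icc hB hCm hθ0 hθ1 hbs hta hts htf hprof h2e' hs1 hs2 hs4 hs5 he hee hne q).2.2
  have hμ : ∀ q, |h q ^ 2 * hh q ^ 2 / (h q + hh q)| ≤ w q / 2 := fun q => by
    have hm := (mu_facts (hsb q).1 (hsbb q).1 (hle q) (hlee q)).2
    rwa [one_div_one_div] at hm
  have hd : ∀ q, |hh q - h q| ≤ 2 / 3 * w q * |δ| ∧ |hh q - h q| ≤ 16 / 3 * e' ^ 3 * |δ| := fun q =>
    abs_sub_pins_le_of_quotient hB hCm hθ0 hθ1 hbs hta hts htf hprof h2e' hs1 hs2 hs4 hs5 he hee hne q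
  have hdρ : ∀ q, |hh q - h q| ≤ ρ := fun q => (hd q).2.trans hρ
  -- the identity: D is a fixed point with Jacobian μ and source 1 + (Σ r)/δ
  have hDfix := quotient_identity (B := B) (e := e) (ee := ee) hCm hθ0 hθ1 hG hsb hsf hsbb hsff hδne hwanti hμ hD
  -- sources: |(Σ_{p<k} r_p)/δ| ≤ (2/3) ε S/(1−θ)
  have hr : ∀ p, |B (fun i => hh (p + 1 + i)) - B (fun i => h (p + 1 + i)) - ∑' j, G (fun i => h (p + 1 + i)) j * (hh (p + 1 + j) - h (p + 1 + j))|
      ≤ ε * (1 * (w (p + 1) * (2 / 3 * |δ|)) / (1 - θ)) := by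
    intro p
    have h1 := hrem (fun i => h (p + 1 + i)) (fun i => hh (p + 1 + i)) (seqBox_shift hsb (p + 1)) (seqBox_shift hsbb (p + 1))
      (fun j => hdρ (p + 1 + j))
    refine h1.trans (mul_le_mul_of_nonneg_left ?_ hε)
    have hrow := (row_summable_abs_le (Cm := 1) (F := fun j => θ ^ j * |hh (p + 1 + j) - h (p + 1 + j)|) hθ0 hθ1 hwanti
      (by positivity : 0 ≤ 2 / 3 * |δ|) zero_le_one p (fun j => ?_)).2
    · exact (le_abs_self _).trans hrow
    · rw [abs_mul, abs_abs, abs_of_nonneg (pow_nonneg hθ0 j)]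
      calc θ ^ j * |hh (p + 1 + j) - h (p + 1 + j)| ≤ θ ^ j * (2 / 3 * w (p + 1 + j) * |δ|) :=
            mul_le_mul_of_nonneg_left (hd _).1 (pow_nonneg hθ0 j)
        _ = 1 * θ ^ j * (w (p + 1 + j) * (2 / 3 * |δ|)) := by ring
  have hsrc : ∀ k, |(1 + (∑ p ∈ range k, (B (fun i => hh (p + 1 + i)) - B (fun i => h (p + 1 + i))
      - ∑' j, G (fun i => h (p + 1 + i)) j * (hh (p + 1 + j) - h (p + 1 + j)))) / δ) - 1| ≤ 2 / 3 * ε * S / (1 - θ) := by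
    intro k
    rw [add_sub_cancel_left, abs_div, div_le_iff₀ (abs_pos.mpr hδne)]
    calc |∑ p ∈ range k, (B (fun i => hh (p + 1 + i)) - B (fun i => h (p + 1 + i))
          - ∑' j, G (fun i => h (p + 1 + i)) j * (hh (p + 1 + j) - h (p + 1 + j)))|
        ≤ ∑ p ∈ range k, |B (fun i => hh (p + 1 + i)) - B (fun i => h (p + 1 + i))
          - ∑' j, G (fun i => h (p + 1 + i)) j * (hh (p + 1 + j) - h (p + 1 + j))| := Finset.abs_sum_le_sum_abs _ _
      _ ≤ ∑ p ∈ range k, ε * (1 * (w (p + 1) * (2 / 3 * |δ|)) / (1 - θ)) := Finset.sum_le_sum fun p _ => hr p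
      _ = ε * (2 / 3 * |δ|) / (1 - θ) * ∑ p ∈ range k, w (p + 1) := by
          rw [Finset.mul_sum]; refine Finset.sum_congr rfl fun p _ => ?_; ring
      _ ≤ ε * (2 / 3 * |δ|) / (1 - θ) * S := mul_le_mul_of_nonneg_left (sum_profWeight_succ_le hbs he' k) (by positivity)
      _ = 2 / 3 * ε * S / (1 - θ) * |δ| := by ring
  -- Jacobians: |c μ − c h³/2| ≤ C_m θ^j · w · (8/3) e′² |δ|
  have hE : ∀ p j, |G (fun i => h (p + 1 + i)) j * (h (p + 1 + j) ^ 2 * hh (p + 1 + j) ^ 2 / (h (p + 1 + j) + hh (p + 1 + j)))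
      - G (fun i => h (p + 1 + i)) j * (h (p + 1 + j) ^ 3 / 2)| ≤ Cm * θ ^ j * (w (p + 1 + j) * (8 / 3 * e' ^ 2 * |δ|)) := by
    intro p j
    set q := p + 1 + j with hq'
    rw [← mul_sub, abs_mul]
    have h1 := abs_mu_sub_cube_le (hsb q).1 (hsbb q).1
    have hsq : h q ^ 2 ≤ 4 * e' ^ 2 := by nlinarith [(hsb q).1, h2 q, he.2, he.1]
    calc |G (fun i => h (p + 1 + i)) j| * |h q ^ 2 * hh q ^ 2 / (h q + hh q) - h q ^ 3 / 2|
        ≤ Cm * θ ^ j * (h q ^ 2 * |hh q - h q|) := mul_le_mul (hc p j) h1 (abs_nonneg _) (by positivity)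
      _ ≤ Cm * θ ^ j * (4 * e' ^ 2 * (2 / 3 * w q * |δ|)) :=
          mul_le_mul_of_nonneg_left (mul_le_mul hsq (hd q).1 (abs_nonneg _) (by positivity)) (by positivity)
      _ = Cm * θ ^ j * (w (p + 1 + j) * (8 / 3 * e' ^ 2 * |δ|)) := by rw [hq']; ring
  have hP := fixedPoint_perturb (c := fun p j => G (fun i => h (p + 1 + i)) j) (c' := fun p j => G (fun i => h (p + 1 + i)) j)
    (v := fun q => h q ^ 2 * hh q ^ 2 / (h q + hh q)) (v' := fun q => h q ^ 3 / 2)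
    (s := fun k => 1 + (∑ p ∈ range k, (B (fun i => hh (p + 1 + i)) - B (fun i => h (p + 1 + i))
      - ∑' j, G (fun i => h (p + 1 + i)) j * (hh (p + 1 + j) - h (p + 1 + j)))) / δ) (s' := fun _ => 1)
    (W := fun q => (1 / (hh q) ^ 2 - 1 / (h q) ^ 2) / δ) (W' := W)
    hCm hθ0 hθ1 hw0 hwanti hwS hq hc hμ hc hv hDfix hD hW hWM hsrc (by positivity) hE k
  -- simplify the constant
  have hX : Cm * S * (8 / 3 * e' ^ 2 * |δ| * 2) / (1 - θ) ≤ 4 / 3 * e' ^ 2 * |δ| := by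
    have h1 : Cm * S * (8 / 3 * e' ^ 2 * |δ| * 2) / (1 - θ) = Cm * S / (1 - θ) * (16 / 3 * e' ^ 2 * |δ|) := by ring
    rw [h1]
    nlinarith [abs_nonneg δ, sq_nonneg e', mul_nonneg (mul_nonneg (by norm_num : (0:ℝ) ≤ 16 / 3) (sq_nonneg e')) (abs_nonneg δ)]
  have hnum : 0 ≤ 2 / 3 * ε * S / (1 - θ) + Cm * S * (8 / 3 * e' ^ 2 * |δ| * 2) / (1 - θ) := by
    have : 0 ≤ S := by positivity
    positivity
  have hden : 7 / 8 ≤ 1 - Cm * S / (2 * (1 - θ)) := by linarith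
  calc |(1 / (hh k) ^ 2 - 1 / (h k) ^ 2) / δ - W k|
      ≤ (2 / 3 * ε * S / (1 - θ) + Cm * S * (8 / 3 * e' ^ 2 * |δ| * 2) / (1 - θ)) / (1 - Cm * S / (2 * (1 - θ))) := hP
    _ ≤ (2 / 3 * ε * S / (1 - θ) + Cm * S * (8 / 3 * e' ^ 2 * |δ| * 2) / (1 - θ)) / (7 / 8) :=
        div_le_div_of_nonneg_left hnum (by norm_num) hden
    _ ≤ 8 / 7 * (2 / 3 * ε * S / (1 - θ) + 4 / 3 * e' ^ 2 * |δ|) := by rw [div_eq_inv_mul]; norm_num; linarith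

/-! ## §115 The limit ẽ → e, uniformly in the scale -/

/-- The chart increment vanishes continuously: `1∕ẽ² − 1∕e² → 0` as ẽ → e (e ≠ 0). [folklore] -/
theorem invSq_sub_invSq_tendsto_zero {e : ℝ} (he : e ≠ 0) : Tendsto (fun x : ℝ => 1 / x ^ 2 - 1 / e ^ 2) (𝓝 e) (𝓝 0) := by
  have hc : ContinuousAt (fun x : ℝ => 1 / x ^ 2) e :=
    (continuousAt_const.div (continuousAt_id.pow 2) (pow_ne_zero 2 he))
  have h := hc.tendsto.sub_const (1 / e ^ 2)
  rwa [sub_self] at h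

/-- **THE CHART QUOTIENTS CONVERGE TO THE TANGENT FLOW, UNIFORMLY IN THE SCALE.**  Part 14's package at e′, part 68's C¹ shape (`hG`, `hGB`), `e ∈ ]0, e′[` INTERIOR, W the tangent
flow at e.  THEN for every ε₀ > 0, for all ẽ ≠ e close enough to e: **`|D_k − W_k| ≤ ε₀` FOR EVERY k** (`D_k = (1∕h̃_k² − 1∕h_k²)∕(1∕ẽ² − 1∕e²)`).
[cite: Balaban1987RG1, Thm 2 (0.31) p.259 with (0.20) p.256 and p.298] -/
theorem quotient_tendsto_tangent_uniform {B : (ℕ → ℝ) → ℝ} {G : (ℕ → ℝ) → ℕ → ℝ} {Cm θ γ bs ta gs e' : ℝ} {t W : ℕ → ℝ}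
    (hB : MemoryProfile Cm θ γ B) (hCm : 0 ≤ Cm) (hθ0 : 0 ≤ θ) (hθ1 : θ < 1) (hbs : 0 < bs) (hta : 0 < ta)
    (hts : SeqBox γ t) (htf : MemFlow B gs t) (hprof : ∀ m : ℕ, 1 / ta ^ 2 + bs * (m : ℝ) ≤ 1 / (t m) ^ 2)
    (hG : ∀ u : ℕ → ℝ, SeqBox γ u → ∀ j, |G u j| ≤ Cm * θ ^ j)
    (hGB : ∀ ε > 0, ∃ ρ > 0, ∀ u u' : ℕ → ℝ, SeqBox γ u → SeqBox γ u' → (∀ j, |u' j - u j| ≤ ρ) →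
      |B u' - B u - ∑' j, G u j * (u' j - u j)| ≤ ε * ∑' j, θ ^ j * |u' j - u j|)
    (h2e' : 2 * e' ≤ γ) (hs1 : 4 * Cm * e' ≤ bs * (1 - θ))
    (hs2 : e' ^ 2 * (1 / gs ^ 2 + Cm * γ / (1 - θ) ^ 2 + (2 * Cm / ((1 - θ) * bs)) ^ 2) ≤ 3 / 4)
    (hs4 : 64 * Cm * e' ^ 3 ≤ (1 - θ) ^ 2) (hs5 : Cm * (8 * e' ^ 3 + 16 * e' / bs) ≤ (1 - θ) / 4) {e : ℝ} (he : e ∈ Ioo (0 : ℝ) e')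
    (hW : ∀ k, W k = 1 - ∑ p ∈ range k, ∑' j, G (fun i => solution B e (p + 1 + i)) j * ((solution B e (p + 1 + j)) ^ 3 / 2) * W (p + 1 + j))
    (hWM : ∀ k, |W k| ≤ 2) {ε₀ : ℝ} (hε₀ : 0 < ε₀) :
    ∀ᶠ ee in 𝓝[≠] e, ∀ k, |(1 / (solution B ee k) ^ 2 - 1 / (solution B e k) ^ 2) / (1 / ee ^ 2 - 1 / e ^ 2) - W k| ≤ ε₀ := by
  have he' : 0 < e' := he.1.trans he.2
  have h1θ : 0 < 1 - θ := by linarith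
  have hec : e ∈ Ioc (0 : ℝ) e' := ⟨he.1, he.2.le⟩
  set S : ℝ := 8 * e' ^ 3 + 16 * e' / bs with hS
  have hS0 : 0 < S := by positivity
  -- choose ε with (8/7)(2/3) ε S/(1−θ) ≤ ε₀/2, then ρ from the remainder letter
  set ε : ℝ := 21 * (1 - θ) * ε₀ / (32 * S) with hεdef
  have hε : 0 < ε := by positivity
  obtain ⟨ρ, hρ, hrem⟩ := hGB ε hε
  -- the chart increment is eventually small
  have hsmall : ∀ᶠ ee in 𝓝 e, |1 / ee ^ 2 - 1 / e ^ 2| < min (3 * ρ / (16 * e' ^ 3)) (21 * ε₀ / (64 * e' ^ 2)) := by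
    have h := invSq_sub_invSq_tendsto_zero he.1.ne'
    have hpos : 0 < min (3 * ρ / (16 * e' ^ 3)) (21 * ε₀ / (64 * e' ^ 2)) := by positivity
    have := (Metric.tendsto_nhds.1 h) _ hpos
    refine this.mono fun ee hee => ?_
    rwa [Real.dist_eq, sub_zero] at hee
  have hmem : ∀ᶠ ee in 𝓝 e, ee ∈ Ioc (0 : ℝ) e' := Filter.eventually_of_mem (Ioo_mem_nhds he.1 he.2) fun x hx => ⟨hx.1, hx.2.le⟩
  have hne : ∀ᶠ ee in 𝓝[≠] e, ee ≠ e := self_mem_nhdsWithin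
  filter_upwards [hne, eventually_nhdsWithin_of_eventually_nhds hsmall, eventually_nhdsWithin_of_eventually_nhds hmem] with ee hne' hsm hee
  intro k
  have hsm1 : |1 / ee ^ 2 - 1 / e ^ 2| < 3 * ρ / (16 * e' ^ 3) := hsm.trans_le (min_le_left _ _)
  have hsm2 : |1 / ee ^ 2 - 1 / e ^ 2| < 21 * ε₀ / (64 * e' ^ 2) := hsm.trans_le (min_le_right _ _)
  have hρ' : 16 / 3 * e' ^ 3 * |1 / ee ^ 2 - 1 / e ^ 2| ≤ ρ := by
    have := (lt_div_iff₀ (by positivity : (0:ℝ) < 16 * e' ^ 3)).mp hsm1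
    linarith
  have hmain := quotient_sub_tangent_abs_le hB hCm hθ0 hθ1 hbs hta hts htf hprof hG hε.le hrem h2e' hs1 hs2 hs4 hs5 hec hee hne' hρ' hW hWM k
  have h1 : 8 / 7 * (2 / 3 * ε * S / (1 - θ)) = ε₀ / 2 := by
    rw [hεdef]; field_simp; ring
  have h2 : 8 / 7 * (4 / 3 * e' ^ 2 * |1 / ee ^ 2 - 1 / e ^ 2|) ≤ ε₀ / 2 := by
    have := (lt_div_iff₀ (by positivity : (0:ℝ) < 64 * e' ^ 2)).mp hsm2
    nlinarith [sq_nonneg e']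
  calc _ ≤ 8 / 7 * (2 / 3 * ε * S / (1 - θ) + 4 / 3 * e' ^ 2 * |1 / ee ^ 2 - 1 / e ^ 2|) := hmain
    _ = 8 / 7 * (2 / 3 * ε * S / (1 - θ)) + 8 / 7 * (4 / 3 * e' ^ 2 * |1 / ee ^ 2 - 1 / e ^ 2|) := by ring
    _ ≤ ε₀ / 2 + ε₀ / 2 := by rw [h1]; exact add_le_add le_rfl h2
    _ = ε₀ := by ring

/-- The scale-wise form: `D_k → W_k` as ẽ → e, for every k. [cite: Balaban1987RG1, Thm 2 (0.31) p.259 with (0.20) p.256] -/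
theorem quotient_tendsto_tangent {B : (ℕ → ℝ) → ℝ} {G : (ℕ → ℝ) → ℕ → ℝ} {Cm θ γ bs ta gs e' : ℝ} {t W : ℕ → ℝ}
    (hB : MemoryProfile Cm θ γ B) (hCm : 0 ≤ Cm) (hθ0 : 0 ≤ θ) (hθ1 : θ < 1) (hbs : 0 < bs) (hta : 0 < ta)
    (hts : SeqBox γ t) (htf : MemFlow B gs t) (hprof : ∀ m : ℕ, 1 / ta ^ 2 + bs * (m : ℝ) ≤ 1 / (t m) ^ 2)
    (hG : ∀ u : ℕ → ℝ, SeqBox γ u → ∀ j, |G u j| ≤ Cm * θ ^ j)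
    (hGB : ∀ ε > 0, ∃ ρ > 0, ∀ u u' : ℕ → ℝ, SeqBox γ u → SeqBox γ u' → (∀ j, |u' j - u j| ≤ ρ) →
      |B u' - B u - ∑' j, G u j * (u' j - u j)| ≤ ε * ∑' j, θ ^ j * |u' j - u j|)
    (h2e' : 2 * e' ≤ γ) (hs1 : 4 * Cm * e' ≤ bs * (1 - θ))
    (hs2 : e' ^ 2 * (1 / gs ^ 2 + Cm * γ / (1 - θ) ^ 2 + (2 * Cm / ((1 - θ) * bs)) ^ 2) ≤ 3 / 4)
    (hs4 : 64 * Cm * e' ^ 3 ≤ (1 - θ) ^ 2) (hs5 : Cm * (8 * e' ^ 3 + 16 * e' / bs) ≤ (1 - θ) / 4) {e : ℝ} (he : e ∈ Ioo (0 : ℝ) e')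
    (hW : ∀ k, W k = 1 - ∑ p ∈ range k, ∑' j, G (fun i => solution B e (p + 1 + i)) j * ((solution B e (p + 1 + j)) ^ 3 / 2) * W (p + 1 + j))
    (hWM : ∀ k, |W k| ≤ 2) (k : ℕ) :
    Tendsto (fun ee => (1 / (solution B ee k) ^ 2 - 1 / (solution B e k) ^ 2) / (1 / ee ^ 2 - 1 / e ^ 2)) (𝓝[≠] e) (𝓝 (W k)) := by
  refine Metric.tendsto_nhds.2 fun ε₀ hε₀ => ?_
  have h := quotient_tendsto_tangent_uniform hB hCm hθ0 hθ1 hbs hta hts htf hprof hG hGB h2e' hs1 hs2 hs4 hs5 he hW hWM (half_pos hε₀)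
  refine h.mono fun ee hee => ?_
  rw [Real.dist_eq]
  exact (hee k).trans_lt (by linarith)

/-! ## §116 The solution is differentiable in its pin at every scale -/

/-- **THE CHART OF THE SOLUTION IS DIFFERENTIABLE IN THE PIN, WITH DERIVATIVE THE TANGENT FLOW READ THROUGH THE CHART**: at every interior pin `e ∈ ]0, e′[` and every
scale k, **`HasDerivAt (e ↦ 1∕(solution B e k)²) (W_k·(−2∕e³)) e`** (the slope is `D_k · (1∕ẽ² − 1∕e²)∕(ẽ − e)`, `D_k → W_k` by §115, the second factor → `(1∕e²)′ = −2∕e³`).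
[cite: Balaban1987RG1, Thm 2 (0.31) p.259 with (0.20) p.256 and p.298] -/
theorem hasDerivAt_invSq_solution {B : (ℕ → ℝ) → ℝ} {G : (ℕ → ℝ) → ℕ → ℝ} {Cm θ γ bs ta gs e' : ℝ} {t W : ℕ → ℝ}
    (hB : MemoryProfile Cm θ γ B) (hCm : 0 ≤ Cm) (hθ0 : 0 ≤ θ) (hθ1 : θ < 1) (hbs : 0 < bs) (hta : 0 < ta)
    (hts : SeqBox γ t) (htf : MemFlow B gs t) (hprof : ∀ m : ℕ, 1 / ta ^ 2 + bs * (m : ℝ) ≤ 1 / (t m) ^ 2)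
    (hG : ∀ u : ℕ → ℝ, SeqBox γ u → ∀ j, |G u j| ≤ Cm * θ ^ j)
    (hGB : ∀ ε > 0, ∃ ρ > 0, ∀ u u' : ℕ → ℝ, SeqBox γ u → SeqBox γ u' → (∀ j, |u' j - u j| ≤ ρ) →
      |B u' - B u - ∑' j, G u j * (u' j - u j)| ≤ ε * ∑' j, θ ^ j * |u' j - u j|)
    (h2e' : 2 * e' ≤ γ) (hs1 : 4 * Cm * e' ≤ bs * (1 - θ))
    (hs2 : e' ^ 2 * (1 / gs ^ 2 + Cm * γ / (1 - θ) ^ 2 + (2 * Cm / ((1 - θ) * bs)) ^ 2) ≤ 3 / 4)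
    (hs4 : 64 * Cm * e' ^ 3 ≤ (1 - θ) ^ 2) (hs5 : Cm * (8 * e' ^ 3 + 16 * e' / bs) ≤ (1 - θ) / 4) {e : ℝ} (he : e ∈ Ioo (0 : ℝ) e')
    (hW : ∀ k, W k = 1 - ∑ p ∈ range k, ∑' j, G (fun i => solution B e (p + 1 + i)) j * ((solution B e (p + 1 + j)) ^ 3 / 2) * W (p + 1 + j))
    (hWM : ∀ k, |W k| ≤ 2) (k : ℕ) :
    HasDerivAt (fun x : ℝ => 1 / (solution B x k) ^ 2) (W k * (-2 / e ^ 3)) e := by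
  rw [hasDerivAt_iff_tendsto_slope, slope_fun_def_field]
  have hD := quotient_tendsto_tangent hB hCm hθ0 hθ1 hbs hta hts htf hprof hG hGB h2e' hs1 hs2 hs4 hs5 he hW hWM k
  -- the chart 1/x² has derivative −2/e³ at e
  have hchart : HasDerivAt (fun x : ℝ => 1 / x ^ 2) (-2 / e ^ 3) e := by
    have h1 : HasDerivAt (fun x : ℝ => x ^ 2) (2 * e) e := by simpa using hasDerivAt_pow 2 e
    have h2 := h1.fun_inv (pow_ne_zero 2 he.1.ne')
    have e3 : -(2 * e) / (e ^ 2) ^ 2 = -2 / e ^ 3 := by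
      rw [div_eq_div_iff (by have := he.1; positivity) (by have := he.1; positivity)]; ring
    rw [← e3]
    refine h2.congr_of_eventuallyEq (Eventually.of_forall fun x => ?_)
    simp [one_div]
  have hslope := (hasDerivAt_iff_tendsto_slope.1 hchart)
  rw [slope_fun_def_field] at hslope
  have hprod := hD.mul hslope
  refine hprod.congr' ?_
  have hmem : ∀ᶠ ee in 𝓝 e, ee ∈ Ioo (0 : ℝ) e' := Ioo_mem_nhds he.1 he.2
  filter_upwards [self_mem_nhdsWithin, eventually_nhdsWithin_of_eventually_nhds hmem] with ee hne hee
  have hδne : 1 / ee ^ 2 - 1 / e ^ 2 ≠ 0 := invSq_sub_ne_zero he.1 hee.1 hne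
  rw [div_mul_div_comm, mul_comm (1 / ee ^ 2 - 1 / e ^ 2), ← div_mul_div_comm, div_self hδne, mul_one]

/-- **THE SOLUTION IS DIFFERENTIABLE IN ITS PIN AT EVERY SCALE**: at every interior pin and every scale k, **`HasDerivAt (e ↦ solution B e k) (W_k·h_k³∕e³) e`**, `h = solution B e`
(chain rule through `h_k = (1∕h_k²)^{−1∕2}`); the derivative is POSITIVE (`W_k ≥ 3∕4`, part 68) — part 14's strict monotonicity in the pin, now to first order with the rate.
[cite: Balaban1987RG1, Thm 2 (0.31) p.259 with (0.20) p.256 and p.298] -/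
theorem hasDerivAt_solution {B : (ℕ → ℝ) → ℝ} {G : (ℕ → ℝ) → ℕ → ℝ} {Cm θ γ bs ta gs e' : ℝ} {t W : ℕ → ℝ}
    (hB : MemoryProfile Cm θ γ B) (hCm : 0 ≤ Cm) (hθ0 : 0 ≤ θ) (hθ1 : θ < 1) (hbs : 0 < bs) (hta : 0 < ta)
    (hts : SeqBox γ t) (htf : MemFlow B gs t) (hprof : ∀ m : ℕ, 1 / ta ^ 2 + bs * (m : ℝ) ≤ 1 / (t m) ^ 2)
    (hG : ∀ u : ℕ → ℝ, SeqBox γ u → ∀ j, |G u j| ≤ Cm * θ ^ j)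
    (hGB : ∀ ε > 0, ∃ ρ > 0, ∀ u u' : ℕ → ℝ, SeqBox γ u → SeqBox γ u' → (∀ j, |u' j - u j| ≤ ρ) →
      |B u' - B u - ∑' j, G u j * (u' j - u j)| ≤ ε * ∑' j, θ ^ j * |u' j - u j|)
    (h2e' : 2 * e' ≤ γ) (hs1 : 4 * Cm * e' ≤ bs * (1 - θ))
    (hs2 : e' ^ 2 * (1 / gs ^ 2 + Cm * γ / (1 - θ) ^ 2 + (2 * Cm / ((1 - θ) * bs)) ^ 2) ≤ 3 / 4)
    (hs4 : 64 * Cm * e' ^ 3 ≤ (1 - θ) ^ 2) (hs5 : Cm * (8 * e' ^ 3 + 16 * e' / bs) ≤ (1 - θ) / 4) {e : ℝ} (he : e ∈ Ioo (0 : ℝ) e')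
    (hW : ∀ k, W k = 1 - ∑ p ∈ range k, ∑' j, G (fun i => solution B e (p + 1 + i)) j * ((solution B e (p + 1 + j)) ^ 3 / 2) * W (p + 1 + j))
    (hWM : ∀ k, |W k| ≤ 2) (k : ℕ) :
    HasDerivAt (fun x : ℝ => solution B x k) (W k * (solution B e k) ^ 3 / e ^ 3) e ∧ 0 < W k * (solution B e k) ^ 3 / e ^ 3 := by
  have hec : e ∈ Ioc (0 : ℝ) e' := ⟨he.1, he.2.le⟩
  have hy := hasDerivAt_invSq_solution hB hCm hθ0 hθ1 hbs hta hts htf hprof hG hGB h2e' hs1 hs2 hs4 hs5 he hW hWM k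
  obtain ⟨hsb, -⟩ := solution_facts hB hCm hθ0 hθ1 hbs hta hts htf hprof h2e' hs1 hs2 hs4 hs5 hec
  have hpos : 0 < solution B e k := (hsb k).1
  have hWpos : 0 < W k :=
    by linarith [(tangent_sub_one_abs_le hB hCm hθ0 hθ1 hbs hta hts htf hprof hG h2e' hs1 hs2 hs4 hs5 hec hW hWM k).2.1]
  refine ⟨?_, by have := he.1; positivity⟩
  -- x ↦ 1/√(1/(solution B x k)²) agrees with the solution near e
  have hne : (1 : ℝ) / (solution B e k) ^ 2 ≠ 0 := by positivity
  have h1 := (hy.sqrt hne).fun_inv (by positivity)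
  have hsq : Real.sqrt (1 / (solution B e k) ^ 2) = 1 / solution B e k := by
    rw [show (1 : ℝ) / (solution B e k) ^ 2 = (1 / solution B e k) ^ 2 by ring, Real.sqrt_sq (by positivity)]
  have hval : -(W k * (-2 / e ^ 3) / (2 * Real.sqrt (1 / (solution B e k) ^ 2))) / Real.sqrt (1 / (solution B e k) ^ 2) ^ 2
      = W k * (solution B e k) ^ 3 / e ^ 3 := by
    rw [hsq]
    have := he.1.ne'
    have := hpos.ne'
    field_simp
  rw [hval] at h1
  refine h1.congr_of_eventuallyEq ?_
  have hmem : ∀ᶠ x in 𝓝 e, x ∈ Ioo (0 : ℝ) e' := Ioo_mem_nhds he.1 he.2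
  refine hmem.mono fun x hx => ?_
  obtain ⟨hsbx, -⟩ := solution_facts hB hCm hθ0 hθ1 hbs hta hts htf hprof h2e' hs1 hs2 hs4 hs5 ⟨hx.1, hx.2.le⟩
  have hpx : 0 < solution B x k := (hsbx k).1
  show solution B x k = (Real.sqrt (1 / (solution B x k) ^ 2))⁻¹
  rw [show (1 : ℝ) / (solution B x k) ^ 2 = (1 / solution B x k) ^ 2 by ring, Real.sqrt_sq (by positivity), one_div, inv_inv]

/-- **THE `deriv` FORM** (v2, completing the header's list): at every interior pin and every scale, `deriv (e ↦ solution B e k) e = W_k·h_k³∕e³ > 0` — THE solution is strictly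
increasing in its pin to first order with an explicit positive rate (part 14's `lt_of_pin_lt`, infinitesimally). [cite: Balaban1987RG1, Thm 2 (0.31) p.259 with (0.20) p.256] -/
theorem deriv_solution_pos {B : (ℕ → ℝ) → ℝ} {G : (ℕ → ℝ) → ℕ → ℝ} {Cm θ γ bs ta gs e' : ℝ} {t W : ℕ → ℝ}
    (hB : MemoryProfile Cm θ γ B) (hCm : 0 ≤ Cm) (hθ0 : 0 ≤ θ) (hθ1 : θ < 1) (hbs : 0 < bs) (hta : 0 < ta)
    (hts : SeqBox γ t) (htf : MemFlow B gs t) (hprof : ∀ m : ℕ, 1 / ta ^ 2 + bs * (m : ℝ) ≤ 1 / (t m) ^ 2)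
    (hG : ∀ u : ℕ → ℝ, SeqBox γ u → ∀ j, |G u j| ≤ Cm * θ ^ j)
    (hGB : ∀ ε > 0, ∃ ρ > 0, ∀ u u' : ℕ → ℝ, SeqBox γ u → SeqBox γ u' → (∀ j, |u' j - u j| ≤ ρ) →
      |B u' - B u - ∑' j, G u j * (u' j - u j)| ≤ ε * ∑' j, θ ^ j * |u' j - u j|)
    (h2e' : 2 * e' ≤ γ) (hs1 : 4 * Cm * e' ≤ bs * (1 - θ))
    (hs2 : e' ^ 2 * (1 / gs ^ 2 + Cm * γ / (1 - θ) ^ 2 + (2 * Cm / ((1 - θ) * bs)) ^ 2) ≤ 3 / 4)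
    (hs4 : 64 * Cm * e' ^ 3 ≤ (1 - θ) ^ 2) (hs5 : Cm * (8 * e' ^ 3 + 16 * e' / bs) ≤ (1 - θ) / 4) {e : ℝ} (he : e ∈ Ioo (0 : ℝ) e')
    (hW : ∀ k, W k = 1 - ∑ p ∈ range k, ∑' j, G (fun i => solution B e (p + 1 + i)) j * ((solution B e (p + 1 + j)) ^ 3 / 2) * W (p + 1 + j))
    (hWM : ∀ k, |W k| ≤ 2) (k : ℕ) :
    deriv (fun x : ℝ => solution B x k) e = W k * (solution B e k) ^ 3 / e ^ 3 ∧ 0 < deriv (fun x : ℝ => solution B x k) e := by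
  obtain ⟨hd, hpos⟩ := hasDerivAt_solution hB hCm hθ0 hθ1 hbs hta hts htf hprof hG hGB h2e' hs1 hs2 hs4 hs5 he hW hWM k
  rw [hd.deriv]
  exact ⟨rfl, hpos⟩

end

end Summit.QuantumFields.BalabanUV.Beta.EriceFlowEnclosureB12AsPrintedHistoryContagionShiftFlowZeroTangentDeriv
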